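import Mathlib.Geometry.Manifold.MFDeriv.NormedSpace
import Mathlib.LinearAlgebra.BilinearForm.Hom
import Literature.Geometry.Lorentzian.LorentzianMetric
import HarnessLib

/-!
# Energy currents of scalar fields: the stress–energy tensor and the vector-field method
(trunk G08 = T-LORENTZ; vocabulary for the linear-wave statements **gr.S24**/**gr.S27**;
namespace `Literature.Lorentz`)

For a `C^n` pseudo-Riemannian metric `g` on the tangent bundle of a real manifold `M` and a scalar
field `ψ : M → ℝ` we define, pointwise and purely algebraically in the first jet `dψ_x`
(Mathlib's `mvfderiv I ψ x : T_x M →L[ℝ] ℝ`),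

* `g.gradSq ψ x = g⁻¹(dψ, dψ) = ∂^α ψ ∂_α ψ` (the prelude's inverse metric `innerDual`);
* `g.stressEnergy ψ x`, the **stress–energy (energy–momentum) tensor** of `ψ` at `x`,
  `T[ψ](X, Y) = (Xψ)(Yψ) − ½ g(X, Y) g⁻¹(dψ, dψ)`, as a `LinearMap.BilinForm ℝ (T_x M)`;
* `g.energyCurrent ψ X x`, the **energy current** `J^X[ψ] = T[ψ](X, ·)` of a multiplier
  vector field `X`, as a covector `Module.Dual ℝ (T_x M)` — so that the energy density measured
  through a hypersurface with future normal `n` is `J^X[ψ](n) = T[ψ](X, n)`.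

These are the objects of the vector-field method (Dafermos–Rodnianski, *Lectures on black holes
and linear waves*, arXiv:0811.0354, §13 of the held text = App. D, p. 56: `T_{μν}(ψ) = ∂_μψ ∂_νψ
− ½ g_{μν} ∂^αψ ∂_αψ`, `J^V_μ(ψ) = V^ν T_{μν}(ψ)`; Dafermos–Rodnianski, arXiv:1010.5132, §4.2;
Hawking–Ellis 1973, §3.3 (3.7) with `m = 0`). They are the vocabulary in which the energy
fluxes `∫_Σ J^N_μ[ψ] n^μ_Σ` of Dafermos–Rodnianski–Shlapentokh-Rothman (arXiv:1402.7034,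
Thm. 3.1, Cor. 3.1) are written; this file is the first, metric-independent layer of that
vocabulary (the Kerr-specific fluxes through hyperboloidal leaves are not defined here).

## Main results (all proved)

* `stressEnergy_apply`, `stressEnergy_symm`, `stressEnergy_const`, `stressEnergy_neg`,
  `energyCurrent_apply`: unfolding and elementary algebra.
* `LorentzianMetric.two_mul_stressEnergy_self_eq`: for a Lorentzian `g` and a timelike `X`,
  writing `♯dψ = λ X + u` with `u ⊥ X`,
  `2 T[ψ](X, X) = (Xψ)² + (−g(X, X)) · g(u, u)` — the multiplier `X` "sees" the transversal
  derivative `Xψ` and, with the weight `−g(X,X) > 0`, the `g`-orthogonal (spacelike) part `u` of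
  the gradient.
* `LorentzianMetric.sq_le_two_mul_stressEnergy_self`, `LorentzianMetric.stressEnergy_self_nonneg`:
  `(Xψ)² ≤ 2 T[ψ](X, X)` and `0 ≤ T[ψ](X, X)` for timelike `X`.
* `LorentzianMetric.sq_val_le_mul_val_of_orthogonal`: Cauchy–Schwarz on the (positive definite)
  `g`-orthogonal complement of a timelike vector.
* `LorentzianMetric.stressEnergy_nonneg_of_isTimelike` (**dominant energy condition**, timelike
  case): `0 ≤ T[ψ](X, Y)` for timelike `X`, `Y` in the same time cone (`g(X, Y) < 0`) — this is
  what makes `J^N_μ n^μ` a non-negative energy density for a timelike multiplier `N` and a future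
  timelike normal `n` (Hawking–Ellis 1973, §4.3); `energyCurrent_nonneg_of_isTimelike` is the
  current form.

## Mathlib and the Literature tree

Mathlib (at the pin) has `mvfderiv` (differential of a vector-valued function on a manifold with
values in the model normed space), `LinearMap.BilinForm.linMulLin f g` (`(x, y) ↦ f x * g y`) and
no stress–energy tensor or energy current (`rg -i 'stress.?energy|energy.?momentum' Mathlib` is
empty). The pointwise linear algebra (`sharp`, `innerDual`) is the H21 prelude's
(`PseudoRiemannianMetric.lean`). **Relation to an existing Literature definition.** The barrier
file `Literature/Barriers/FinalStateConjecture/HairyKerrBifurcation.lean` defines, in this same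
namespace, the energy–momentum tensor `PseudoRiemannianMetric.kgStressEnergy μsq Ψ` of a
*complex* Klein–Gordon field `Ψ : M → ℂ` of mass `μ²` (Chodosh–Shlapentokh-Rothman, CMP 356
(2017), §1), built from `reDifferential`/`imDifferential` and `innerDual` exactly as here. The
present `stressEnergy ψ` is its real massless special case:
`g.stressEnergy ψ x = g.kgStressEnergy 0 (fun y ↦ (ψ y : ℂ)) x` (pointwise
`reDifferential I (fun y ↦ (ψ y : ℂ)) x = ↑(mvfderiv I ψ x)` by `rfl` and the imaginary
differential vanishes by `mfderiv_const`). The trunk (this file, imported by the Kerr wave-decay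
files) must not import `Literature/Barriers`, so the real massless tensor is defined here and the
bridge lemma `stressEnergy = kgStressEnergy 0 ∘ (↑)` is left to a follow-up item on the barrier
file, after which `kgStressEnergy`'s API can be refactored onto this one.

## Design choices

* Everything is pointwise in `x` and algebraic in `dψ_x`; no differentiability hypothesis is
  needed to *define* the objects (Mathlib's `mvfderiv` has junk value `0` where `ψ` is not
  differentiable, and then `T[ψ]_x = 0`).
* `T[ψ]_x` is a `LinearMap.BilinForm` (like the prelude's `hessian`, `ricci`), built from
  `linMulLin dψ dψ` and `g.toBilinForm x`, so that Mathlib's bilinear-form algebra applies; the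
  current `J^X` is the partially applied form, a `Module.Dual`.
* Finite-dimensionality of the model space `[FiniteDimensional ℝ E]` is assumed throughout (it is
  needed for `g⁻¹` via the prelude's `sharp`).
* The deformation-tensor bulk term `K^X = T^{μν} ∇_{(μ}X_{ν)}` and the divergence identity
  `∇^μ J^X_μ = K^X + (Xψ) □_g ψ` need the Levi-Civita connection and are left to a sequel; only
  the flux vocabulary is needed to *state* energy-boundedness and energy-decay results.

## References

* M. Dafermos, I. Rodnianski, *Lectures on black holes and linear waves*, Clay Math. Proc. 17
  (2013) 97–205, arXiv:0811.0354, §13 (= App. D of the arXiv version), p. 56 of the held text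
  (key `DafermosRodnianski2008`).
* M. Dafermos, I. Rodnianski, *Decay for solutions of the wave equation on Kerr exterior
  spacetimes I–II*, arXiv:1010.5132, §4.2 (key `DafermosRodnianski2010`).
* M. Dafermos, I. Rodnianski, Y. Shlapentokh-Rothman, arXiv:1402.7034 = Ann. of Math. 183 (2016),
  Thm. 3.1, Cor. 3.1 (key `DafermosRodnianskiShlapentokhrothman2014`).
* S. W. Hawking, G. F. R. Ellis, *The large scale structure of space-time* (1973), §3.3, §4.3.
* B. O'Neill, *Semi-Riemannian geometry* (1983), Ch. 5, Lemma 5.26 (key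
  `ONeillSemiRiemannian1983`).
-/

noncomputable section

open Bundle Set
open scoped Manifold ContDiff Topology

namespace Literature.Geometry.Lorentzian

variable {E : Type*} [NormedAddCommGroup E] [NormedSpace ℝ E] {H : Type*} [TopologicalSpace H]
  {I : ModelWithCorners ℝ E H} {M : Type*} [TopologicalSpace M] [ChartedSpace H M]
  [IsManifold I ∞ M] {n : ℕ∞ω} [FiniteDimensional ℝ E]

namespace PseudoRiemannianMetric

variable (g : PseudoRiemannianMetric I n E (TangentSpace I : M → Type _))

/-! ### The gradient square and the stress–energy tensor -/

/-- The **gradient square** `g⁻¹(dψ, dψ) = ∂^α ψ ∂_α ψ = g(∇ψ, ∇ψ)` of a scalar field `ψ` at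
`x` (inverse metric `innerDual` of the prelude applied to the differential `mvfderiv I ψ x`; of
either sign for an indefinite metric). Dafermos–Rodnianski, arXiv:0811.0354, §13 (App. D),
p. 56. [cite: DafermosRodnianski2008, §13 (App. D) p. 56] -/
def gradSq (ψ : M → ℝ) (x : M) : ℝ :=
  g.innerDual x (mvfderiv I ψ x : TangentSpace I x →ₗ[ℝ] ℝ) (mvfderiv I ψ x)

/-- `g⁻¹(dψ, dψ) = dψ (♯ dψ)`. Dafermos–Rodnianski, arXiv:0811.0354, §13 (App. D), p. 56. [cite: DafermosRodnianski2008, §13 (App. D) p. 56] -/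
lemma gradSq_eq (ψ : M → ℝ) (x : M) :
    g.gradSq ψ x =
      mvfderiv I ψ x (g.sharp x (mvfderiv I ψ x : TangentSpace I x →ₗ[ℝ] ℝ)) :=
  rfl

/-- The **stress–energy (energy–momentum) tensor** of a (real, massless) scalar field `ψ` at
`x`: `T[ψ]_x (X, Y) = (Xψ)(Yψ) − ½ g_x(X, Y) g⁻¹(dψ, dψ)`, i.e.
`T_{μν}[ψ] = ∂_μψ ∂_νψ − ½ g_{μν} ∂^αψ ∂_αψ`, as a bilinear form on `T_x M`. This is the case
`μ² = 0`, `Ψ = ψ` real, of the Klein–Gordon energy–momentum tensor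
`PseudoRiemannianMetric.kgStressEnergy μsq Ψ` of
`Literature/Barriers/FinalStateConjecture/HairyKerrBifurcation.lean`
(`g.stressEnergy ψ x = g.kgStressEnergy 0 (fun y ↦ (ψ y : ℂ)) x`; module docstring).
Dafermos–Rodnianski, *Lectures on black holes and linear waves*, arXiv:0811.0354, §13 (App. D),
p. 56; Dafermos–Rodnianski arXiv:1010.5132, §4.2; Hawking–Ellis 1973, §3.3 (3.7), `m = 0`. [cite: DafermosRodnianski2008, §13 (App. D) p. 56] -/
def stressEnergy (ψ : M → ℝ) (x : M) : LinearMap.BilinForm ℝ (TangentSpace I x) :=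
  LinearMap.BilinForm.linMulLin (mvfderiv I ψ x : TangentSpace I x →ₗ[ℝ] ℝ) (mvfderiv I ψ x) -
    (g.gradSq ψ x / 2) • g.toBilinForm x

/-- Unfolding lemma: `T[ψ](X, Y) = (Xψ)(Yψ) − ½ g(X, Y) g⁻¹(dψ, dψ)` with `Xψ = dψ_x(X)`.
Dafermos–Rodnianski, arXiv:0811.0354, §13 (App. D), p. 56. [cite: DafermosRodnianski2008, §13 (App. D) p. 56] -/
@[simp]
lemma stressEnergy_apply (ψ : M → ℝ) (x : M) (X Y : TangentSpace I x) :
    g.stressEnergy ψ x X Y =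
      mvfderiv I ψ x X * mvfderiv I ψ x Y - g.gradSq ψ x / 2 * g.val x X Y := by
  simp [stressEnergy, LinearMap.BilinForm.linMulLin_apply]

/-- The stress–energy tensor is symmetric: `T_{μν} = T_{νμ}`. Dafermos–Rodnianski,
arXiv:0811.0354, §13 (App. D), p. 56. [cite: DafermosRodnianski2008, §13 (App. D) p. 56] -/
lemma stressEnergy_symm (ψ : M → ℝ) (x : M) (X Y : TangentSpace I x) :
    g.stressEnergy ψ x X Y = g.stressEnergy ψ x Y X := by
  rw [stressEnergy_apply, stressEnergy_apply, g.symm x X Y, mul_comm (mvfderiv I ψ x X)]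

/-- The stress–energy tensor is a symmetric bilinear form (`LinearMap.BilinForm.IsSymm`).
Dafermos–Rodnianski, arXiv:0811.0354, §13 (App. D), p. 56. [cite: DafermosRodnianski2008, §13 (App. D) p. 56] -/
lemma isSymm_stressEnergy (ψ : M → ℝ) (x : M) : (g.stressEnergy ψ x).IsSymm :=
  ⟨fun X Y ↦ g.stressEnergy_symm ψ x X Y⟩

/-- The gradient square of a constant vanishes. Dafermos–Rodnianski, arXiv:0811.0354, §13
(App. D), p. 56. [folklore] -/
@[simp]
lemma gradSq_const (c : ℝ) (x : M) : g.gradSq (fun _ : M ↦ c) x = 0 := by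
  simp [gradSq, mvfderiv_const, innerDual]

/-- Constants carry no energy: `T[c] = 0`. Dafermos–Rodnianski, arXiv:0811.0354, §13 (App. D),
p. 56. [folklore] -/
@[simp]
lemma stressEnergy_const (c : ℝ) (x : M) : g.stressEnergy (fun _ : M ↦ c) x = 0 := by
  ext X Y
  simp [mvfderiv_const]

/-- The gradient square is even: `g⁻¹(d(−ψ), d(−ψ)) = g⁻¹(dψ, dψ)`. Dafermos–Rodnianski,
arXiv:0811.0354, §13 (App. D), p. 56. [folklore] -/
@[simp]
lemma gradSq_neg (ψ : M → ℝ) (x : M) : g.gradSq (-ψ) x = g.gradSq ψ x := by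
  simp [gradSq, mvfderiv_neg, innerDual]

/-- The stress–energy tensor is quadratic, in particular even, in `ψ`: `T[−ψ] = T[ψ]`.
Dafermos–Rodnianski, arXiv:0811.0354, §13 (App. D), p. 56. [folklore] -/
@[simp]
lemma stressEnergy_neg (ψ : M → ℝ) (x : M) : g.stressEnergy (-ψ) x = g.stressEnergy ψ x := by
  ext X Y
  simp [mvfderiv_neg]

/-! ### Energy currents -/

/-- The **energy current** of the multiplier vector field `X` (a section of `TM`, in Mathlib's
`Π x, TangentSpace I x` form): the covector `J^X[ψ]_x = T[ψ]_x (X_x, ·)`, i.e.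
`J^X_μ[ψ] = T_{μν}[ψ] X^ν`. Its value on the future unit normal `n` of a spacelike
hypersurface, `J^X[ψ](n) = T[ψ](X, n)`, is the energy density whose integral is the flux
`∫_Σ J^X_μ[ψ] n^μ_Σ`. Dafermos–Rodnianski, arXiv:0811.0354, §13 (App. D), p. 56
(`J^V_μ(ψ) = V^ν T_{μν}(ψ)`); arXiv:1010.5132, §4.2. [cite: DafermosRodnianski2008, §13 (App. D) p. 56] -/
def energyCurrent (ψ : M → ℝ) (X : Π x : M, TangentSpace I x) (x : M) :
    Module.Dual ℝ (TangentSpace I x) :=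
  g.stressEnergy ψ x (X x)

/-- Unfolding lemma: `J^X[ψ]_x (Y) = T[ψ]_x (X_x, Y)`. Dafermos–Rodnianski, arXiv:0811.0354,
§13 (App. D), p. 56. [cite: DafermosRodnianski2008, §13 (App. D) p. 56] -/
@[simp]
lemma energyCurrent_apply (ψ : M → ℝ) (X : Π x : M, TangentSpace I x) (x : M)
    (Y : TangentSpace I x) : g.energyCurrent ψ X x Y = g.stressEnergy ψ x (X x) Y :=
  rfl

/-- The energy current of a constant field vanishes. Dafermos–Rodnianski, arXiv:0811.0354, §13
(App. D), p. 56. [folklore] -/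
@[simp]
lemma energyCurrent_const (c : ℝ) (X : Π x : M, TangentSpace I x) (x : M) :
    g.energyCurrent (fun _ : M ↦ c) X x = 0 := by
  ext Y
  simp

/-- `J^X[ψ](Y) = J^Y[ψ](X)`: the energy density is symmetric in multiplier and normal
(symmetry of `T`). Dafermos–Rodnianski, arXiv:0811.0354, §13 (App. D), p. 56. [cite: DafermosRodnianski2008, §13 (App. D) p. 56] -/
lemma energyCurrent_apply_comm (ψ : M → ℝ) (X Y : Π x : M, TangentSpace I x) (x : M) :
    g.energyCurrent ψ X x (Y x) = g.energyCurrent ψ Y x (X x) :=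
  g.stressEnergy_symm ψ x (X x) (Y x)

end PseudoRiemannianMetric

/-! ### Positivity for Lorentzian metrics (diagonal dominant energy condition) -/

namespace LorentzianMetric

variable (g : LorentzianMetric I n M) {x : M}

omit [FiniteDimensional ℝ E] in
/-- The `g`-orthogonal projection used in the energy estimates: for a timelike `X` (so
`g(X, X) ≠ 0`) and any `ξ`, the vector `ξ − (g(ξ, X)/g(X, X)) X` is `g`-orthogonal to `X`.
O'Neill 1983, Ch. 5, Lemma 5.26 (the orthogonal complement of a timelike vector).
[cite: ONeillSemiRiemannian1983, Ch. 5 Lemma 5.26] -/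
lemma val_sub_smul_eq_zero {X : TangentSpace I x} (hX : g.IsTimelike X) (ξ : TangentSpace I x) :
    g.val x X (ξ - (g.val x ξ X / g.val x X X) • X) = 0 := by
  have hX0 : g.val x X X ≠ 0 := ne_of_lt hX
  simp only [map_sub, map_smul, smul_eq_mul]
  rw [g.symm x X ξ]
  field_simp
  ring

/-- **Energy identity for a timelike multiplier.** For a Lorentzian metric `g`, a timelike
vector `X` and a scalar field `ψ`, decompose the gradient `♯dψ = λ X + u` with `u ⊥ X`
(`u = ♯dψ − (Xψ / g(X,X)) X`). Then
`2 T[ψ](X, X) = (Xψ)² + (−g(X, X)) · g(u, u)`.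
This is the algebra behind the coercivity of `J^N_μ n^μ` (Dafermos–Rodnianski,
arXiv:0811.0354, §13 = App. D, p. 56 for `T`, `J^N`); O'Neill 1983, Ch. 5, Lemma 5.26
(the orthogonal complement of a timelike vector is spacelike). Elementary algebra. [folklore] -/
theorem two_mul_stressEnergy_self_eq {X : TangentSpace I x} (hX : g.IsTimelike X) (ψ : M → ℝ) :
    2 * g.stressEnergy ψ x X X =
      (mvfderiv I ψ x X) ^ 2 +
        (-g.val x X X) *
          g.val x
            (g.sharp x (mvfderiv I ψ x : TangentSpace I x →ₗ[ℝ] ℝ) -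
              (mvfderiv I ψ x X / g.val x X X) • X)
            (g.sharp x (mvfderiv I ψ x : TangentSpace I x →ₗ[ℝ] ℝ) -
              (mvfderiv I ψ x X / g.val x X X) • X) := by
  have hX0 : g.val x X X ≠ 0 := ne_of_lt hX
  -- abbreviations: `ξ = ♯dψ`, `a = g(X,X)`, `b = Xψ = g(ξ, X)`, `q = g(ξ, ξ) = g⁻¹(dψ,dψ)`
  set ξ : TangentSpace I x := g.sharp x (mvfderiv I ψ x : TangentSpace I x →ₗ[ℝ] ℝ) with hξ
  have hb : g.val x ξ X = mvfderiv I ψ x X := by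
    rw [hξ, g.val_sharp_apply]
    rfl
  have hq : g.toPseudoRiemannianMetric.gradSq ψ x = g.val x ξ ξ := by
    rw [PseudoRiemannianMetric.gradSq, PseudoRiemannianMetric.innerDual_eq_val_sharp_sharp]
  have hXξ : g.val x X ξ = g.val x ξ X := g.symm x X ξ
  rw [g.stressEnergy_apply, hq, ← hb]
  simp only [map_sub, map_smul, smul_eq_mul, FunLike.coe_sub, FunLike.coe_smul,
    Pi.sub_apply, Pi.smul_apply, hXξ]
  field_simp
  ring

/-- For a timelike multiplier `X`, `(Xψ)² ≤ 2 T[ψ](X, X)`: the energy density controls the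
transversal derivative (the `g`-orthogonal part of the gradient is spacelike, O'Neill 1983, Ch. 5,
Lemma 5.26; the scalar-field energy–momentum tensor satisfies the dominant energy condition,
Hawking–Ellis 1973, §4.3). [cite: HawkingEllis1973, §4.3] -/
theorem sq_le_two_mul_stressEnergy_self {X : TangentSpace I x} (hX : g.IsTimelike X)
    (ψ : M → ℝ) : (mvfderiv I ψ x X) ^ 2 ≤ 2 * g.stressEnergy ψ x X X := by
  rw [g.two_mul_stressEnergy_self_eq hX ψ]
  have hperp := g.val_sub_smul_eq_zero hX
    (g.sharp x (mvfderiv I ψ x : TangentSpace I x →ₗ[ℝ] ℝ))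
  have hb : g.val x (g.sharp x (mvfderiv I ψ x : TangentSpace I x →ₗ[ℝ] ℝ)) X =
      mvfderiv I ψ x X := by
    rw [g.val_sharp_apply]
    rfl
  rw [hb] at hperp
  have hsp := g.isSpacelike_of_orthogonal hX hperp
  have hnn : 0 ≤ g.val x
      (g.sharp x (mvfderiv I ψ x : TangentSpace I x →ₗ[ℝ] ℝ) - (mvfderiv I ψ x X / g.val x X X) • X)
      (g.sharp x (mvfderiv I ψ x : TangentSpace I x →ₗ[ℝ] ℝ) - (mvfderiv I ψ x X / g.val x X X) • X) := by
    rcases hsp with h | h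
    · exact h.le
    · rw [h]; simp
  have ha : 0 ≤ -g.val x X X := by
    have := hX
    rw [LorentzianMetric.isTimelike_iff] at this
    linarith
  nlinarith [mul_nonneg ha hnn]

/-- **Non-negativity of the energy density for a timelike multiplier**: `0 ≤ T[ψ](X, X)` for
timelike `X` (the diagonal case of the dominant energy condition for the massless scalar field,
Hawking–Ellis 1973, §4.3; the objects `T`, `J^X` are those of Dafermos–Rodnianski,
arXiv:0811.0354, §13 = App. D, p. 56). [cite: HawkingEllis1973, §4.3] -/
theorem stressEnergy_self_nonneg {X : TangentSpace I x} (hX : g.IsTimelike X) (ψ : M → ℝ) :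
    0 ≤ g.stressEnergy ψ x X X := by
  have h := g.sq_le_two_mul_stressEnergy_self hX ψ
  nlinarith [sq_nonneg (mvfderiv I ψ x X)]

omit [FiniteDimensional ℝ E] in
/-- **Cauchy–Schwarz on the orthogonal complement of a timelike vector**: if `u, e ⊥ X` with
`X` timelike, then `g(u, e)² ≤ g(u, u) g(e, e)` (the complement is positive definite, O'Neill
1983, Ch. 5, Lemma 5.26, so the usual discriminant argument applies).
[cite: ONeillSemiRiemannian1983, Ch. 5 Lemma 5.26] -/
lemma sq_val_le_mul_val_of_orthogonal {X u e : TangentSpace I x} (hX : g.IsTimelike X)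
    (hu : g.val x X u = 0) (he : g.val x X e = 0) :
    g.val x u e ^ 2 ≤ g.val x u u * g.val x e e := by
  have hnn : ∀ w : TangentSpace I x, g.val x X w = 0 → 0 ≤ g.val x w w := by
    intro w hw
    rcases g.isSpacelike_of_orthogonal hX hw with h | h
    · exact h.le
    · rw [h]; simp
  have heu : g.val x e u = g.val x u e := g.symm x e u
  have hquad : ∀ t : ℝ, 0 ≤ g.val x e e * (t * t) + 2 * g.val x u e * t + g.val x u u := by
    intro t
    have h := hnn (u + t • e) (by simp [hu, he])
    simp only [map_add, map_smul, smul_eq_mul, FunLike.coe_add, FunLike.coe_smul,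
      Pi.add_apply, Pi.smul_apply, heu] at h
    nlinarith [h]
  have hd := discrim_le_zero hquad
  rw [discrim] at hd
  nlinarith [hd]

/-- **Dominant energy condition for the massless scalar field (timelike case).** For a
Lorentzian metric `g`, two timelike vectors `X`, `Y` in the same time cone (`g(X, Y) < 0`) and
any scalar field `ψ`, the energy density is non-negative: `0 ≤ T[ψ](X, Y) = J^X[ψ](Y)`. This is
the positivity of the flux density `J^N_μ n^μ` of a timelike multiplier `N` through a spacelike
hypersurface with future normal `n` (Dafermos–Rodnianski, arXiv:0811.0354, §13 = App. D, p. 56,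
and App. C; Hawking–Ellis 1973, §4.3: the scalar-field energy–momentum tensor obeys the dominant
energy condition). Proof: decompose `Y = αX + e`, `♯dψ = λX + u` with `e, u ⊥ X`; then
`T(X,Y) = ½αλ²a² + λ a g(u,e) + ½α(−a) g(u,u)` with `a = g(X,X) < 0 < α`, and the middle term is
absorbed by Cauchy–Schwarz on `X^⊥` and `g(e,e) < α²(−a)` (timelikeness of `Y`).
[cite: HawkingEllis1973, §4.3] -/
theorem stressEnergy_nonneg_of_isTimelike {X Y : TangentSpace I x} (hX : g.IsTimelike X)
    (hY : g.IsTimelike Y) (hXY : g.val x X Y < 0) (ψ : M → ℝ) :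
    0 ≤ g.stressEnergy ψ x X Y := by
  -- notation: `a = g(X,X) < 0`, `ξ = ♯dψ`, `α = g(Y,X)/a`, `e = Y − αX`, `λ = g(ξ,X)/a`, `u = ξ − λX`
  have ha : g.val x X X < 0 := hX
  have hX0 : g.val x X X ≠ 0 := ne_of_lt ha
  set a : ℝ := g.val x X X with ha_def
  set ξ : TangentSpace I x := g.sharp x (mvfderiv I ψ x : TangentSpace I x →ₗ[ℝ] ℝ) with hξ
  set α : ℝ := g.val x Y X / a with hα
  set e : TangentSpace I x := Y - α • X with he_def
  set l : ℝ := g.val x ξ X / a with hl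
  set u : TangentSpace I x := ξ - l • X with hu_def
  -- orthogonality of `e` and `u` to `X`
  have he : g.val x X e = 0 := by
    rw [he_def, hα]
    exact g.val_sub_smul_eq_zero hX Y
  have hu : g.val x X u = 0 := by
    rw [hu_def, hl]
    exact g.val_sub_smul_eq_zero hX ξ
  -- the differential in terms of `ξ`
  have hdψ : ∀ Z : TangentSpace I x, mvfderiv I ψ x Z = g.val x ξ Z := by
    intro Z
    rw [hξ, g.val_sharp_apply]
    rfl
  have hq : g.toPseudoRiemannianMetric.gradSq ψ x = g.val x ξ ξ := by
    rw [PseudoRiemannianMetric.gradSq, PseudoRiemannianMetric.innerDual_eq_val_sharp_sharp]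
  -- rewrite `Y` and `ξ` through the decompositions
  have hY' : Y = α • X + e := by rw [he_def]; abel
  have hξ' : ξ = l • X + u := by rw [hu_def]; abel
  have huX : g.val x u X = 0 := by rw [g.symm]; exact hu
  have heX : g.val x e X = 0 := by rw [g.symm]; exact he
  have hXY' : g.val x X Y = α * a := by
    rw [hY']
    simp [he, ha_def]
  have hξY : g.val x ξ Y = l * α * a + g.val x u e := by
    rw [hξ', hY']
    simp only [map_add, map_smul, smul_eq_mul, FunLike.coe_add, FunLike.coe_smul,
      Pi.add_apply, Pi.smul_apply, he, huX, ha_def]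
    ring
  have hξX : g.val x ξ X = l * a := by
    rw [hl]
    field_simp
  have hξξ : g.val x ξ ξ = l ^ 2 * a + g.val x u u := by
    conv_lhs => rw [hξ']
    simp only [map_add, map_smul, smul_eq_mul, FunLike.coe_add, FunLike.coe_smul,
      Pi.add_apply, Pi.smul_apply, hu, huX, ha_def]
    ring
  -- signs
  have hα_pos : 0 < α := by
    rw [hα, g.symm x Y X]
    exact div_pos_of_neg_of_neg hXY ha
  have huu : 0 ≤ g.val x u u := by
    rcases g.isSpacelike_of_orthogonal hX hu with h | h
    · exact h.le
    · rw [h]; simp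
  have hee_nn : 0 ≤ g.val x e e := by
    rcases g.isSpacelike_of_orthogonal hX he with h | h
    · exact h.le
    · rw [h]; simp
  have hee : g.val x e e < α ^ 2 * (-a) := by
    have hYY : g.val x Y Y < 0 := hY
    rw [hY'] at hYY
    simp only [map_add, map_smul, smul_eq_mul, FunLike.coe_add, FunLike.coe_smul,
      Pi.add_apply, Pi.smul_apply, he, heX, ← ha_def] at hYY
    nlinarith [hYY]
  have hCS := g.sq_val_le_mul_val_of_orthogonal hX hu he
  have hm : g.val x u e ^ 2 ≤ α ^ 2 * (-a) * g.val x u u := by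
    calc g.val x u e ^ 2 ≤ g.val x u u * g.val x e e := hCS
      _ ≤ g.val x u u * (α ^ 2 * (-a)) := mul_le_mul_of_nonneg_left hee.le huu
      _ = α ^ 2 * (-a) * g.val x u u := by ring
  -- the value of `T(X, Y)`
  have hT : g.stressEnergy ψ x X Y =
      α * l ^ 2 * a ^ 2 / 2 + l * a * g.val x u e + α * (-a) * g.val x u u / 2 := by
    rw [g.stressEnergy_apply, hq, hdψ, hdψ, hξX, hξY, hξξ, hXY']
    ring
  rw [hT]
  -- `2α · T ≥ (αla + m)² − m² + α²(−a) g(u,u) ≥ 0`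
  have h2 : 0 ≤ 2 * α * (α * l ^ 2 * a ^ 2 / 2 + l * a * g.val x u e +
      α * (-a) * g.val x u u / 2) := by
    nlinarith [sq_nonneg (α * l * a + g.val x u e), hm]
  nlinarith [h2, hα_pos]

/-- The flux density `J^X[ψ](Y) = T[ψ](X, Y)` of a timelike multiplier `X` through a
hypersurface element with timelike normal `Y` in the same time cone is non-negative (dominant
energy condition for the scalar field, Hawking–Ellis 1973, §4.3; current `J^X` of
Dafermos–Rodnianski, arXiv:0811.0354, §13 = App. D, p. 56). [cite: HawkingEllis1973, §4.3] -/
theorem energyCurrent_nonneg_of_isTimelike (ψ : M → ℝ) (X : Π x : M, TangentSpace I x)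
    {Y : TangentSpace I x} (hX : g.IsTimelike (X x)) (hY : g.IsTimelike Y)
    (hXY : g.val x (X x) Y < 0) : 0 ≤ g.energyCurrent ψ X x Y :=
  g.stressEnergy_nonneg_of_isTimelike hX hY hXY ψ

/-- The energy density `J^X[ψ](X) = T[ψ](X, X)` of a timelike multiplier measured through
itself is non-negative (Hawking–Ellis 1973, §4.3; current `J^X` of Dafermos–Rodnianski,
arXiv:0811.0354, §13 = App. D, p. 56). [cite: HawkingEllis1973, §4.3] -/
theorem energyCurrent_self_nonneg (ψ : M → ℝ) (X : Π x : M, TangentSpace I x)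
    (hX : g.IsTimelike (X x)) : 0 ≤ g.energyCurrent ψ X x (X x) :=
  g.stressEnergy_self_nonneg hX ψ

end LorentzianMetric

end Literature.Geometry.Lorentzian

end
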